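import Literature.NumberTheory.LFunctions.Zhang2022.Section10TentMellin
import Literature.NumberTheory.LFunctions.Zhang2022.Section10RemarkShift
import HarnessLib

/-!
# Zhang (2022) §10, the Remark on p. 56 (`Z22:§10.u031`): the shifted Mellin formula for `f̃` holds

Topic `Literature/NumberTheory/LFunctions/Zhang2022` (Landau–Siegel audit tree; verdict-neutral).
Y. Zhang, *Discrete mean estimates and the Landau–Siegel zero*, arXiv:2211.02515v1 (2022)
[Zhang2022LandauSiegel] — **an unrefereed manuscript under adjudication**; theorem-only file,
campaign siegel-zhang DAG node `Z22:§10.u031` [Z22 p.56, tex L2883], Remark after Lemma 10.2: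
"Similar to (10.6),
`f̃(log y/log P + 0.004 − α̃) = (500/log P)·(1/2πi)∫_{(1)} (Dt₀/P^{0.004})^s((P′₁)^s − 2(P′₂)^s + (P′₃)^s) y^{−s} ds/s²`."
The typed node `Typed.Sec10B.RemarkMellinShift` (L3-t2, `TypedSection10B`) is DISCHARGED here by
composing L3-t2's landed edge `Typed.Sec10B.remarkMellinShift_of_eq106` (the substitution
`y ↦ yP^{0.004}/(Dt₀)`, `Section10RemarkShift`) with the (A)-free identity (10.6) proved in
`Section10TentMellin` (`Skeleton.eq106`: Perron kernel + tent identity, every `y > 0`, `D ≥ 2`).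
Nothing about the manuscript's Theorems 1–2 is asserted.

## References

* Y. Zhang, arXiv:2211.02515v1 (2022), §10 (10.6) p. 54 and the Remark p. 56.
  [cite: Zhang2022LandauSiegel, §10 p. 56]
-/

noncomputable section

open Complex Real
open Literature.NumberTheory.LFunctions.Zhang2022.Skeleton
open Literature.NumberTheory.LFunctions.Zhang2022.Typed

namespace Literature.NumberTheory.LFunctions.Zhang2022.Typed.Sec10B

/-- **(10.6), (A)-free, in the standing-quantifier form** consumed by `remarkMellinShift_of_eq106`:
for `D ≥ 2` and every `y > 0`, `f̃(log y/log P) = (500/log P)·lineInt 1 (((P′₁)^s − 2(P′₂)^s + (P′₃)^s)/y^s/s²)`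
(`Skeleton.eq106`, restated over `Sec10A.lineInt/Pp1/Pp2/Pp3`). [cite: Zhang2022LandauSiegel, §10 (10.6) p. 54] -/
theorem eq106_forAllLarge : ForAllLarge fun D _ _ => ∀ y : ℝ, 0 < y →
    (ftilde (Real.log y / Real.log (bigP D)) : ℂ) =
      (500 : ℂ) / (Real.log (bigP D) : ℂ) *
        Sec10A.lineInt 1 (fun s => ((Sec10A.Pp1 D : ℂ) ^ s - 2 * (Sec10A.Pp2 D : ℂ) ^ s +
          (Sec10A.Pp3 D : ℂ) ^ s) / (y : ℂ) ^ s / s ^ 2) := by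
  refine ⟨2, fun D _ χ hD _ _ y hy => ?_⟩
  have hℓ : 0 < ell D := Real.log_pos (by exact_mod_cast hD)
  rw [Skeleton.eq106 hℓ hy, Sec10A.lineInt]
  congr 2
  refine MeasureTheory.integral_congr_ae (Filter.Eventually.of_forall fun t => ?_)
  simp only [Sec10A.Pp1, Sec10A.Pp2, Sec10A.Pp3, Complex.ofReal_one, Complex.cpow_neg]
  ring

/-- **`Z22:§10.u031` DISCHARGED**: the typed Remark `Typed.Sec10B.RemarkMellinShift` holds — L3-t2's
edge `remarkMellinShift_of_eq106` applied to `eq106_forAllLarge`.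
[cite: Zhang2022LandauSiegel, §10 p. 56, tex L2883] -/
theorem remarkMellinShift_holds : RemarkMellinShift :=
  remarkMellinShift_of_eq106 eq106_forAllLarge

/-- `RemarkMellinShift` — `_holds` alias of `remarkMellinShift_holds` above under the fact's exact name (appended
2026-08-28, D-0026 bookkeeping: the proof term is the existing theorem of this file; no statement,
definition or attribute is edited; no new named fact; the ledger's debt table listed the fact
unproved). [cite: Zhang2022LandauSiegel, §10 p. 56, tex L2883] -/
theorem _root_.Literature.NumberTheory.LFunctions.Zhang2022.Typed.Sec10B.RemarkMellinShift_holds :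
    RemarkMellinShift :=
  _root_.Literature.NumberTheory.LFunctions.Zhang2022.Typed.Sec10B.remarkMellinShift_holds

end Literature.NumberTheory.LFunctions.Zhang2022.Typed.Sec10B
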